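import Summits.QuantumFields.BalabanUV.Beta.GAN24.WilsonFaceGradedIdentity
import Summits.QuantumFields.BalabanUV.Beta.GAN24.ThreeFaceRecLiteral

/-!
# `BalabanUV.Beta.GAN24.ThreeFaceRecClosed` — binder row G-an2-4 ∕ (CONV-C), W-slot CT-W, route «WC-TL», table fact «3F-REC» ∕ «S3C-REC» (PRICING Q-S3C):
# **THE «S3C-REC» CHAIN WITH ITS LAST TABLE HYPOTHESIS DISCHARGED** — (T-W)_face for `3 ≤ Lc` (every period `Lc^{k+1}`, every `(γ, α, β)`), «S3C-REC» EVERY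
# MEMBER (the three `HasSum … 0` slot clauses of `unitS sf sm (SpureRecAt …)`, every `j`, NO table hypothesis), the D1 literal from {(C)sym, (Q-D), (Q-D-rate)}
# (+ the displayed pins) — gen 62's `…_of_gradedWilson` capstones with `hG :=` part 2's `WilsonFaceGradedIdentity.sum_box1_graded_wilsonA_eq_zero` —, and the
# reference-tower rows F2a-comb ∕ (U) ∕ (U-drift) of gen 61's `SourceBracketCombOfS3c` with their «S3C-REC» hypothesis `h3` DISCHARGED

NOT IN PRINT; OUR BOOKKEEPING (six one-line specialisations BY NAME — gen 62's H `WilsonThreeFaceGraded.threeFace_wilsonA_of_graded`, Fl v3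
`ThreeFaceRecOfLetters.hasSum_unitS_SpureRecAt_of_gradedWilson`, Literal `ThreeFaceRecLiteral.exists_allScalesSeq_JsRowD1Pin_of_gradedWilson_C_QD`, and gen 61's three
`SourceBracketCombOfS3c` rows — at the kernel theorem (W-face) of part 2; G-an2-4 formalisation swarm, leaf prover `b2b-balaban-gan24-formalise-leaf-04`, gen 63; part 3 of 3).  HONEST FRAMING (cell contract,
verbatim): «discharging `BetaPertH` makes Bałaban's UV stability UNCONDITIONAL — a real constructive-QFT result; it is NOT the continuum limit and NOT the Clay
problem.»  HONEST DEPENDENCY (verbatim): «continuum YM on T⁴ ⇐ BetaPertH ∧ nine spine estimates (0/9 proved); BetaPertH ⇐ (D1) ∧ (D4) ∧ CAP+tail; G-an2-4 gates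
asym, D1 and NE2/3/4.»

WHAT ([folklore]; 0 `def`, 0 cited facts, 0 `def … : Prop`, 0 sorry): §1 **`threeFace_wilsonA`** — the period-`Lc^{k+1}` three-face-legs cell form of
`wilsonA d γ` vanishes (generic `d`, `3 ≤ Lc`; = the hypothesis `hW` of Fl's `threeFace_rec_of_wilsonFace` ∕ `hasSum_unitS_SpureRecAt_of_wilsonFace` at every
`(k, γ, α, β)`); §2 **`hasSum_unitS_SpureRecAt`** — «S3C-REC» EVERY MEMBER: for `3 ≤ Lc`, `r ∈ box (d+1) Lc`, ANY pins `cE cVH cΛ`, every level `j`, units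
`sf sm`, slot `(κ, s)` and field pair `(a, b)`, the three slot-charge clauses (slot summed with either leg; both legs) of `unitS sf sm (SpureRecAt d Lc (toSite r) cE
cVH cΛ j)` are `HasSum … 0` — NO hypothesis on any table; §3 **`exists_allScalesSeq_JsRowD1Pin_of_C_QD`** — at `d = 3`: the D1 literal
`∃ κ θ, 0 ≤ θ < 1 ∧ AllScalesSeq (j ↦ secondMoment (TbalOf Lc (JsRowD1Pin hodd N) j) μ ν) κ θ` from the pinned constants as displayed and the THREE letters
(C)sym `hC`, (Q-D) `hY`, (Q-D-rate) `hYr` ONLY (Literal's binders verbatim, `hG` gone); §4 (`d = 3`, `3 ≤ Lc`) **`hZ_comb`** (F2a-comb of the reference tower, both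
conjuncts, every level), **`t2Shape_undressedComb_three`** (row (U)), **`exists_hU_three_pinEq`** (row (U-drift)) — gen 61's `hZ_comb_of_S3c` ∕
`t2Shape_undressedComb_three_of_S3c` ∕ `exists_hU_three_of_S3c_pinEq` with `h3 := hasSum_unitS_SpureRecAt` at the units `sfStep ∕ smStep`, i.e. modulo the displayed
`vh₂S` shape ∕ covariance hypotheses and pins ONLY.  READING for the refuter's PRICING (Q-S3C «S3C-REC members ≥ 1, typed supplier NONE»): §2 is a typed supplier
with no table hypothesis.  Discharges NOTHING of (C)sym ∕ (Q-D) ∕ (Q-D-rate), of «T2Shape» ∕ «T2Drift» for the DRESSED literal tower (§4 is the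
REFERENCE tower only), or of (hW, hWall) of the other rows; NOT «D1 closed» (its three letters stand); NEVER «G-an2-4 closed» as (CONV-C); NOT D1, NOT `BetaPertH`, NOT continuum, NOT Clay.  2026-08-22; no existing
file touched.
-/

noncomputable section

open Finset
open scoped BigOperators
open Literature.MathematicalPhysics.QuantumFieldTheory
open Literature.MathematicalPhysics.QuantumFieldTheory.Balaban1983to89
open Literature.MathematicalPhysics.QuantumFieldTheory.Balaban1983to89.Beta
open ExpKernelCalculus (Site MKer)
open AffineAveraging (box toSite)
open OneStepResolventKernel (Fib)
open OneStepKernelFamily (KInvStep TbalOf)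
open Summit.QuantumFields.BalabanUV.Beta.HessKerDressedUnits (unitS)
open Summit.QuantumFields.BalabanUV.Beta.SpineRooted (SpureRecAt T2RecOf T2RecAt M1At)
open Summit.QuantumFields.BalabanUV.Beta.SecondOrderUnits (unitS₂)
open Summit.QuantumFields.BalabanUV.Beta.GAN24.CombesThomas (sfStep smStep)
open Summit.QuantumFields.BalabanUV.Beta.GAN24.BiStencilZeroMode (Tab zmode)
open AveragingMixedJetTables (mixFFAt)
open BalabanCompositeJets (LocStencil₂)
open RemainderConstAllScales (AllScalesSeq)
open AveragingContoursRooted (ctrOff)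
open WilsonVertex2Sym (wsym22)
open Summit.QuantumFields.BalabanUV.Beta.AxialDressingRooted (dressKBmAt coProjBmAtK)
open Summit.QuantumFields.BalabanUV.Beta.SecondOrderSocketIdentification (vh₂SAn1)
open Summit.QuantumFields.BalabanUV.Beta.RowD1JointEnd (JsRowD1Pin)
open StepJetData (wilsonA)
open ExpKernelCalculus (shiftK)
open SecondOrderResponse (W2SymOfK)
open BalabanStepW2 (K3OfK M2Of)
open BalabanStepJetsSucc (mmRead)
open Summit.QuantumFields.BalabanUV.Beta.HessKerDressedUnits (unitK)
open Summit.QuantumFields.BalabanUV.Beta.SecondOrderUnits (unitM unitM₂)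
open Summit.QuantumFields.BalabanUV.Beta.GAN24.SourceBracketCombOfS3c (hZ_comb_of_S3c t2Shape_undressedComb_three_of_S3c exists_hU_three_of_S3c_pinEq)
open Summit.QuantumFields.BalabanUV.Beta.GAN24.WilsonFaceGradedIdentity (sum_box1_graded_wilsonA_eq_zero)

namespace Summit.QuantumFields.BalabanUV.Beta.GAN24.ThreeFaceRecClosed

variable {d : ℕ} {Lc : ℕ}

/-! ## §1 (T-W)_face — the cubic-Wilson three-face-legs cell form vanishes -/

/-- [folklore] **(T-W)_face** — for `3 ≤ Lc`, every `k` and all `(γ, α, β)`: the slot of `wilsonA d γ` summed over the `γ`-exit face of the period-`Lc^{k+1}` block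
against the two leg exit-face indicators vanishes (gen 62's `WilsonThreeFaceGraded.threeFace_wilsonA_of_graded` at part 2's (W-face)). -/
theorem threeFace_wilsonA (hLc : 3 ≤ Lc) (k : ℕ) (γ α β : Fin (d + 1)) :
    ∑ v ∈ box (d + 1) (Lc ^ (k + 1)), (if toSite v γ % ((Lc ^ (k + 1) : ℕ) : ℤ) = ((Lc ^ (k + 1) : ℕ) : ℤ) - 1 then (1 : ℝ) else 0) *
        ∑' yw : Site (d + 1) × Site (d + 1),
          (if yw.1 α % ((Lc ^ (k + 1) : ℕ) : ℤ) = ((Lc ^ (k + 1) : ℕ) : ℤ) - 1 then (1 : ℝ) else 0) *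
            (if yw.2 β % ((Lc ^ (k + 1) : ℕ) : ℤ) = ((Lc ^ (k + 1) : ℕ) : ℤ) - 1 then (1 : ℝ) else 0) *
            wilsonA d γ (toSite v) yw.1 yw.2 (Sum.inl α) (Sum.inl β) = 0 :=
  WilsonThreeFaceGraded.threeFace_wilsonA_of_graded hLc k γ α β (sum_box1_graded_wilsonA_eq_zero γ α β)

/-! ## §2 «S3C-REC» — every member, no table hypothesis -/

section Srec

variable [NeZero Lc] {r : Fin (d + 1) → ℕ}

/-- [folklore] **«S3C-REC», EVERY MEMBER** — for `3 ≤ Lc`, `r ∈ box (d+1) Lc`, any pins `cE cVH cΛ`, every `j`, `sf sm`, `(κ, a, b, s)`: the three slot-charge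
clauses of `unitS sf sm (SpureRecAt d Lc (toSite r) cE cVH cΛ j)` are `HasSum … 0` (Fl v3's `hasSum_unitS_SpureRecAt_of_gradedWilson` with `hG` DISCHARGED by
part 2's (W-face)). -/
theorem hasSum_unitS_SpureRecAt (hLc : 3 ≤ Lc) (hr : r ∈ box (d + 1) Lc) (cE cVH cΛ : ℝ) (j : ℕ) (sf sm : ℝ) (κ a b : Fin (d + 1))
    (s : Site (d + 1)) :
    HasSum (fun p : Site (d + 1) × Site (d + 1) =>
        unitS sf sm (SpureRecAt d Lc (toSite r) cE cVH cΛ j) κ s p.1 p.2 (Sum.inl a) (Sum.inl b)) 0 ∧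
      HasSum (fun p : Site (d + 1) × Site (d + 1) =>
        unitS sf sm (SpureRecAt d Lc (toSite r) cE cVH cΛ j) κ p.1 p.2 s (Sum.inl a) (Sum.inl b)) 0 ∧
      HasSum (fun p : Site (d + 1) × Site (d + 1) =>
        unitS sf sm (SpureRecAt d Lc (toSite r) cE cVH cΛ j) κ p.1 s p.2 (Sum.inl a) (Sum.inl b)) 0 :=
  ThreeFaceRecOfLetters.hasSum_unitS_SpureRecAt_of_gradedWilson hLc hr cE cVH cΛ (fun γ α β => sum_box1_graded_wilsonA_eq_zero γ α β)
    j sf sm κ a b s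

end Srec

/-! ## §3 The D1 literal from (C)sym ∧ (Q-D) ∧ (Q-D-rate) alone -/

section Literal

variable [NeZero Lc] {r : Fin (3 + 1) → ℕ}

/-- [folklore] **THE D1 LITERAL ⟸ {(C)sym, (Q-D), (Q-D-rate)}** (`d = 3`, `Lc` odd, `2 ≤ Lc`, pinned constants as displayed): Literal's
`exists_allScalesSeq_JsRowD1Pin_of_gradedWilson_C_QD` with its table hypothesis `hG` DISCHARGED by part 2's (W-face) — every other binder verbatim. -/
theorem exists_allScalesSeq_JsRowD1Pin_of_C_QD (hodd : Odd Lc) (hLc : 2 ≤ Lc) (N : ℕ) {cE cVH cΛ cE₂ cB : ℝ}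
    {Tc : Fin 4 → Fin 4 → Fin 4 → Fin 4 → ℝ} {vh₂S : Tab 3}
    (hρ : r = ctrOff (3 + 1) Lc) (hcE : cE = (Lc : ℝ) ^ 4) (hcVH : cVH = -((Lc : ℝ) ^ 8 / 2)) (hcΛ : cΛ = 2 / (Lc : ℝ) ^ 4) (hcE₂ : cE₂ = (Lc : ℝ) ^ 8)
    (hcB : cB = -((Lc : ℝ) ^ 12 / 4)) (hTc : Tc = (8 * (N : ℝ) ^ 2)⁻¹ • wsym22 N) (hvh : vh₂S = vh₂SAn1 Lc)
    {CY δY CY' θY δY' : ℝ}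
    (hC : ∀ (i : ℕ) (κ κ' κ₁ κ₂ : Fin (3 + 1)),
      zmode Lc (unitS₂ (sfStep Lc i) (smStep 3 Lc i) (T2RecAt 3 Lc (toSite r) cE cVH cΛ cE₂ cB Tc vh₂S (mixFFAt (toSite r) Lc) i)) κ κ' (Sum.inl κ₁) (Sum.inl κ₂)
          + zmode Lc (unitS₂ (sfStep Lc i) (smStep 3 Lc i) (T2RecAt 3 Lc (toSite r) cE cVH cΛ cE₂ cB Tc vh₂S (mixFFAt (toSite r) Lc) i)) κ' κ (Sum.inl κ₁) (Sum.inl κ₂)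
        = zmode Lc (unitS₂ (sfStep Lc i) (smStep 3 Lc i) (T2RecOf 3 Lc (fun j => KInvStep (d := 3) Lc j) (SpureRecAt 3 Lc (toSite r) cE cVH cΛ) (M1At 3 Lc (toSite r) cΛ) cE₂ cB Tc vh₂S (mixFFAt (toSite r) Lc) i)) κ κ' (Sum.inl κ₁) (Sum.inl κ₂)
          + zmode Lc (unitS₂ (sfStep Lc i) (smStep 3 Lc i) (T2RecOf 3 Lc (fun j => KInvStep (d := 3) Lc j) (SpureRecAt 3 Lc (toSite r) cE cVH cΛ) (M1At 3 Lc (toSite r) cΛ) cE₂ cB Tc vh₂S (mixFFAt (toSite r) Lc) i)) κ' κ (Sum.inl κ₁) (Sum.inl κ₂))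
    (hY : ∀ m : ℕ, LocStencil₂ ((fun κ u κ' u' => dressKBmAt (toSite r) Lc (coProjBmAtK (toSite r) Lc (fun κ₁ u₁ => coProjBmAtK (toSite r) Lc
            ((unitS₂ (sfStep Lc m) (smStep 3 Lc m) (T2RecAt 3 Lc (toSite r) cE cVH cΛ cE₂ cB Tc vh₂S (mixFFAt (toSite r) Lc) m)) κ₁ u₁) κ' u') κ u)) -
          (unitS₂ (sfStep Lc m) (smStep 3 Lc m) (T2RecAt 3 Lc (toSite r) cE cVH cΛ cE₂ cB Tc vh₂S (mixFFAt (toSite r) Lc) m))) CY δY) (hδY : 0 < δY)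
    (hYr : ∀ m : ℕ, LocStencil₂ (((fun κ u κ' u' => dressKBmAt (toSite r) Lc (coProjBmAtK (toSite r) Lc (fun κ₁ u₁ => coProjBmAtK (toSite r) Lc
            ((unitS₂ (sfStep Lc (m + 1)) (smStep 3 Lc (m + 1)) (T2RecAt 3 Lc (toSite r) cE cVH cΛ cE₂ cB Tc vh₂S (mixFFAt (toSite r) Lc) (m + 1))) κ₁ u₁) κ' u') κ u)) -
          (unitS₂ (sfStep Lc (m + 1)) (smStep 3 Lc (m + 1)) (T2RecAt 3 Lc (toSite r) cE cVH cΛ cE₂ cB Tc vh₂S (mixFFAt (toSite r) Lc) (m + 1)))) -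
      ((fun κ u κ' u' => dressKBmAt (toSite r) Lc (coProjBmAtK (toSite r) Lc (fun κ₁ u₁ => coProjBmAtK (toSite r) Lc
            ((unitS₂ (sfStep Lc m) (smStep 3 Lc m) (T2RecAt 3 Lc (toSite r) cE cVH cΛ cE₂ cB Tc vh₂S (mixFFAt (toSite r) Lc) m)) κ₁ u₁) κ' u') κ u)) -
          (unitS₂ (sfStep Lc m) (smStep 3 Lc m) (T2RecAt 3 Lc (toSite r) cE cVH cΛ cE₂ cB Tc vh₂S (mixFFAt (toSite r) Lc) m)))) (CY' * θY ^ m) δY') (hθY0 : 0 ≤ θY) (hθY1 : θY < 1) (hδY' : 0 < δY') (μ ν : Fin 4) :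
    ∃ κ θ : ℝ, 0 ≤ θ ∧ θ < 1 ∧ AllScalesSeq (fun j => B12Beta.secondMoment (TbalOf Lc (JsRowD1Pin hodd N) j) μ ν) κ θ :=
  ThreeFaceRecLiteral.exists_allScalesSeq_JsRowD1Pin_of_gradedWilson_C_QD hodd hLc N hρ hcE hcVH hcΛ hcE₂ hcB hTc hvh
    (fun γ α β => sum_box1_graded_wilsonA_eq_zero γ α β) hC hY hδY hYr hθY0 hθY1 hδY' μ ν

end Literal

/-! ## §4 The reference-tower rows of route «WC-TL» without «S3C-REC» (gen 61's `SourceBracketCombOfS3c` with `h3` DISCHARGED) -/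

section Reference

variable [NeZero Lc] {r : Fin (3 + 1) → ℕ}

/-- [folklore] **F2a-comb OF THE REFERENCE TOWER, BOTH CONJUNCTS, EVERY LEVEL** (`d = 3`, `3 ≤ Lc`, in-block root, any pins `cE cVH cΛ cE₂ cB`, any `Tc`, a
border table `vh₂S` with the displayed shape ∕ covariance hypotheses): gen 61's `hZ_comb_of_S3c` with its «S3C-REC» hypothesis `h3` DISCHARGED by §2. -/
theorem hZ_comb (hLc : 3 ≤ Lc) (hr : r ∈ box (3 + 1) Lc) (cE cVH cΛ cE₂ cB : ℝ)
    (Tc : Fin 4 → Fin 4 → Fin 4 → Fin 4 → ℝ) {vh₂S : Tab 3}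
    (hBff : ∀ κ u κ' u' x z (α β : Fin (3 + 1)), vh₂S κ u κ' u' x z (Sum.inl α) (Sum.inl β) = 0)
    (hBmm : ∀ κ u κ' u' x z (μ ν : Fin (3 + 1)), vh₂S κ u κ' u' x z (Sum.inr μ) (Sum.inr ν) = 0)
    {CB δB : ℝ} (hB : LocStencil₂ vh₂S CB δB) (hδB : 0 < δB)
    (hBt : ∀ (κ : Fin (3 + 1)) (u : Fin (3 + 1) → ℤ) (κ' : Fin (3 + 1)) (u' t : Fin (3 + 1) → ℤ),
      vh₂S κ (u + (Lc : ℤ) • t) κ' (u' + (Lc : ℤ) • t) = shiftK (-((Lc : ℤ) • t)) (vh₂S κ u κ' u')) :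
    ∀ i : ℕ,
      (∀ κ u κ' u' t,
          (cE₂ * (Lc : ℝ) ^ (2 * (3 + 1))) •
              mmRead Lc (K3OfK (unitK (sfStep Lc i) (smStep 3 Lc i) (KInvStep (d := 3) Lc i)) Lc
              (unitS (sfStep Lc i) (smStep 3 Lc i) (SpureRecAt 3 Lc (toSite r) cE cVH cΛ i)) (unitM (sfStep Lc i) (smStep 3 Lc i) (M1At 3 Lc (toSite r) cΛ i))
              (W2SymOfK (unitK (sfStep Lc i) (smStep 3 Lc i) (KInvStep (d := 3) Lc i)) Lc
                (unitS (sfStep Lc i) (smStep 3 Lc i) (SpureRecAt 3 Lc (toSite r) cE cVH cΛ i)) (unitM (sfStep Lc i) (smStep 3 Lc i) (M1At 3 Lc (toSite r) cΛ i)) 0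
                (unitM₂ (sfStep Lc i) (smStep 3 Lc i) (M2Of 3 Lc (mixFFAt (toSite r) Lc) i))) κ (u + (Lc : ℤ) • t) κ' (u' + (Lc : ℤ) • t)) + cB • vh₂S κ (u + (Lc : ℤ) • t) κ' (u' + (Lc : ℤ) • t) =
        shiftK (-((Lc : ℤ) • t)) ((cE₂ * (Lc : ℝ) ^ (2 * (3 + 1))) •
              mmRead Lc (K3OfK (unitK (sfStep Lc i) (smStep 3 Lc i) (KInvStep (d := 3) Lc i)) Lc
              (unitS (sfStep Lc i) (smStep 3 Lc i) (SpureRecAt 3 Lc (toSite r) cE cVH cΛ i)) (unitM (sfStep Lc i) (smStep 3 Lc i) (M1At 3 Lc (toSite r) cΛ i))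
              (W2SymOfK (unitK (sfStep Lc i) (smStep 3 Lc i) (KInvStep (d := 3) Lc i)) Lc
                (unitS (sfStep Lc i) (smStep 3 Lc i) (SpureRecAt 3 Lc (toSite r) cE cVH cΛ i)) (unitM (sfStep Lc i) (smStep 3 Lc i) (M1At 3 Lc (toSite r) cΛ i)) 0
                (unitM₂ (sfStep Lc i) (smStep 3 Lc i) (M2Of 3 Lc (mixFFAt (toSite r) Lc) i))) κ u κ' u') + cB • vh₂S κ u κ' u')) ∧
      (∀ κ κ' κ₁ κ₂,
        zmode Lc (fun κ u κ' u' => (cE₂ * (Lc : ℝ) ^ (2 * (3 + 1))) •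
              mmRead Lc (K3OfK (unitK (sfStep Lc i) (smStep 3 Lc i) (KInvStep (d := 3) Lc i)) Lc
              (unitS (sfStep Lc i) (smStep 3 Lc i) (SpureRecAt 3 Lc (toSite r) cE cVH cΛ i)) (unitM (sfStep Lc i) (smStep 3 Lc i) (M1At 3 Lc (toSite r) cΛ i))
              (W2SymOfK (unitK (sfStep Lc i) (smStep 3 Lc i) (KInvStep (d := 3) Lc i)) Lc
                (unitS (sfStep Lc i) (smStep 3 Lc i) (SpureRecAt 3 Lc (toSite r) cE cVH cΛ i)) (unitM (sfStep Lc i) (smStep 3 Lc i) (M1At 3 Lc (toSite r) cΛ i)) 0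
                (unitM₂ (sfStep Lc i) (smStep 3 Lc i) (M2Of 3 Lc (mixFFAt (toSite r) Lc) i))) κ u κ' u') + cB • vh₂S κ u κ' u') κ κ' (Sum.inl κ₁) (Sum.inl κ₂) +
        zmode Lc (fun κ u κ' u' => (cE₂ * (Lc : ℝ) ^ (2 * (3 + 1))) •
              mmRead Lc (K3OfK (unitK (sfStep Lc i) (smStep 3 Lc i) (KInvStep (d := 3) Lc i)) Lc
              (unitS (sfStep Lc i) (smStep 3 Lc i) (SpureRecAt 3 Lc (toSite r) cE cVH cΛ i)) (unitM (sfStep Lc i) (smStep 3 Lc i) (M1At 3 Lc (toSite r) cΛ i))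
              (W2SymOfK (unitK (sfStep Lc i) (smStep 3 Lc i) (KInvStep (d := 3) Lc i)) Lc
                (unitS (sfStep Lc i) (smStep 3 Lc i) (SpureRecAt 3 Lc (toSite r) cE cVH cΛ i)) (unitM (sfStep Lc i) (smStep 3 Lc i) (M1At 3 Lc (toSite r) cΛ i)) 0
                (unitM₂ (sfStep Lc i) (smStep 3 Lc i) (M2Of 3 Lc (mixFFAt (toSite r) Lc) i))) κ u κ' u') + cB • vh₂S κ u κ' u') κ' κ (Sum.inl κ₁) (Sum.inl κ₂) = 0)  :=
  hZ_comb_of_S3c (le_trans (by norm_num) hLc) hr cE cVH cΛ cE₂ cB Tc hBff hBmm hB hδB hBt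
    (fun i κ a b s => hasSum_unitS_SpureRecAt hLc hr cE cVH cΛ i (sfStep Lc i) (smStep 3 Lc i) κ a b s)

/-- [folklore] **ROW (U) — «T2Shape» OF THE REFERENCE TOWER** (`d = 3`, `3 ≤ Lc`, pin `cE = Lc⁴`, `|cE₂| ≤ Lc⁸`): gen 61's `t2Shape_undressedComb_three_of_S3c`
with `h3` DISCHARGED by §2 — modulo the displayed `vh₂S` hypotheses ONLY. -/
theorem t2Shape_undressedComb_three (hLc : 3 ≤ Lc) (hr : r ∈ box (3 + 1) Lc) {cE : ℝ} (hcE : cE = (Lc : ℝ) ^ (3 + 1)) (cVH cΛ cE₂ cB : ℝ)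
    (Tc : Fin 4 → Fin 4 → Fin 4 → Fin 4 → ℝ) {vh₂S : Tab 3}
    (hBff : ∀ κ u κ' u' x z (α β : Fin (3 + 1)), vh₂S κ u κ' u' x z (Sum.inl α) (Sum.inl β) = 0)
    (hBmm : ∀ κ u κ' u' x z (μ ν : Fin (3 + 1)), vh₂S κ u κ' u' x z (Sum.inr μ) (Sum.inr ν) = 0)
    {CB δB : ℝ} (hB : LocStencil₂ vh₂S CB δB) (hδB : 0 < δB)
    (hBt : ∀ (κ : Fin (3 + 1)) (u : Fin (3 + 1) → ℤ) (κ' : Fin (3 + 1)) (u' t : Fin (3 + 1) → ℤ),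
      vh₂S κ (u + (Lc : ℤ) • t) κ' (u' + (Lc : ℤ) • t) = shiftK (-((Lc : ℤ) • t)) (vh₂S κ u κ' u'))
    (hpin : |cE₂| ≤ (Lc : ℝ) ^ (2 * (3 + 1))) :
    ∃ C₂ δ₂ : ℝ, 0 < δ₂ ∧ ∀ j, LocStencil₂ (unitS₂ (sfStep Lc j) (smStep 3 Lc j)
      (T2RecOf 3 Lc (fun j => KInvStep (d := 3) Lc j) (SpureRecAt 3 Lc (toSite r) cE cVH cΛ) (M1At 3 Lc (toSite r) cΛ) cE₂ cB Tc vh₂S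
        (mixFFAt (toSite r) Lc) j)) C₂ δ₂  :=
  t2Shape_undressedComb_three_of_S3c (le_trans (by norm_num) hLc) hr hcE cVH cΛ cE₂ cB Tc hBff hBmm hB hδB hBt hpin
    (fun i κ a b s => hasSum_unitS_SpureRecAt hLc hr cE cVH cΛ i (sfStep Lc i) (smStep 3 Lc i) κ a b s)

/-- [folklore] **ROW (U-drift) — THE `hU` QUINTUPLE OF THE REFERENCE TOWER** (`d = 3`, `3 ≤ Lc`, pins `cE = Lc⁴`, `cE₂ = Lc⁸`): gen 61's
`exists_hU_three_of_S3c_pinEq` with `h3` DISCHARGED by §2 — modulo the displayed `vh₂S` hypotheses ONLY. -/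
theorem exists_hU_three_pinEq (hLc : 3 ≤ Lc) (hr : r ∈ box (3 + 1) Lc) {cE : ℝ} (hcE : cE = (Lc : ℝ) ^ (3 + 1)) (cVH cΛ cE₂ cB : ℝ)
    (Tc : Fin 4 → Fin 4 → Fin 4 → Fin 4 → ℝ) {vh₂S : Tab 3}
    (hBff : ∀ κ u κ' u' x z (α β : Fin (3 + 1)), vh₂S κ u κ' u' x z (Sum.inl α) (Sum.inl β) = 0)
    (hBmm : ∀ κ u κ' u' x z (μ ν : Fin (3 + 1)), vh₂S κ u κ' u' x z (Sum.inr μ) (Sum.inr ν) = 0)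
    {CB δB : ℝ} (hB : LocStencil₂ vh₂S CB δB) (hδB : 0 < δB)
    (hBt : ∀ (κ : Fin (3 + 1)) (u : Fin (3 + 1) → ℤ) (κ' : Fin (3 + 1)) (u' t : Fin (3 + 1) → ℤ),
      vh₂S κ (u + (Lc : ℤ) • t) κ' (u' + (Lc : ℤ) • t) = shiftK (-((Lc : ℤ) • t)) (vh₂S κ u κ' u'))
    (hpinEq : cE₂ = (Lc : ℝ) ^ (2 * (3 + 1))) :
    ∃ cU ϑU δU : ℝ, 0 ≤ cU ∧ 0 ≤ ϑU ∧ ϑU < 1 ∧ 0 < δU ∧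
      ∀ n : ℕ, LocStencil₂ ((fun n : ℕ => unitS₂ (sfStep Lc n) (smStep 3 Lc n)
            (T2RecOf 3 Lc (fun j => KInvStep (d := 3) Lc j) (SpureRecAt 3 Lc (toSite r) cE cVH cΛ) (M1At 3 Lc (toSite r) cΛ) cE₂ cB Tc vh₂S
              (mixFFAt (toSite r) Lc) n)) (n + 1) -
          (fun n : ℕ => unitS₂ (sfStep Lc n) (smStep 3 Lc n)
            (T2RecOf 3 Lc (fun j => KInvStep (d := 3) Lc j) (SpureRecAt 3 Lc (toSite r) cE cVH cΛ) (M1At 3 Lc (toSite r) cΛ) cE₂ cB Tc vh₂S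
              (mixFFAt (toSite r) Lc) n)) n) (cU * ϑU ^ n) δU  :=
  exists_hU_three_of_S3c_pinEq (le_trans (by norm_num) hLc) hr hcE cVH cΛ cE₂ cB Tc hBff hBmm hB hδB hBt hpinEq
    (fun i κ a b s => hasSum_unitS_SpureRecAt hLc hr cE cVH cΛ i (sfStep Lc i) (smStep 3 Lc i) κ a b s)

end Reference

end Summit.QuantumFields.BalabanUV.Beta.GAN24.ThreeFaceRecClosed

end
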